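/-
Copyright (c) 2026 the pub-hodgecm-mathlib formalisation cell (harness21).  Prover seat hodgecm-mathlib-F0P3a-p06 (g30): P6b wave C row (ii)-alg
«MODULE DESCENT IN BASE-CHANGE DATA FORM» (desk F0P6b-plan (g14) RE-CUT 09:53:12Z + seam s7 OF RECORD 09:55:16Z, «=» 10:03:26Z; LEAD F0P6-plan (g8)
«M-153f»; boxes LA-ref2 (g7) ∕ F0P6-ref1 (g9), node F0P3a-p01 (g24); scheme-side partner «L2» LA2-p02 (g8) `RelativeSpec/TorsorQuotientModuleChart`),
2026-09-03.
-/
import Literature.RingTheory.Flat.FaithfullyFlatModuleDescent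
import Literature.RingTheory.Flat.AmitsurDescentData
import Mathlib.RingTheory.Flat.FaithfullyFlat.Basic
import HarnessLib

/-!
# Effective descent of modules in BASE-CHANGE DATA FORM (what the sections of a quasi-coherent sheaf with a descent datum satisfy on one chart)

Topic `Literature/RingTheory/Flat`, namespace `Literature.RingTheory.Flat.ModuleDescentData`.  THEOREMS ONLY; no definition, no named fact, no
instance, no notation, no `sorry`.  This is ★ `Flat/FaithfullyFlatModuleDescent` (effective faithfully flat descent for modules, [SGA1] Exp. VIII
Thm. 1.1 ∕ [StacksProject, Tag 023N] ∕ [GortzWedhorn2020] Thm. 14.68, in the comodule spelling `θ : M →ₗ[S] S ⊗[R] M`, `hε`, `hδ`) read ONE LEVEL UP,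
exactly as ★ `Flat/AmitsurDescentData` reads ★ `Flat/AmitsurDegreeZero`: the rings `S ⊗_R S`, `S ⊗_R S ⊗_R S` and the modules `S ⊗_R P`,
`S ⊗_R S ⊗_R P` are replaced by DATA given up to isomorphism — as they arise from a quasi-coherent module `E` on `X`, an fpqc cover `X → Y` and its
2-truncated Čech nerve `X ⇇ X ×_Y X ⇚ X ×_Y X ×_Y X` read on affine charts `V ⊆ Y`, `U ⊆ X`, `W ⊆ X ×_Y X`, `W₃ ⊆ X ×_Y X ×_Y X` (for a torsor
quotient `X → X⁄G`: `W = G × U`, `W₃ = G × G × U`, [MumfordAV1970] §12 Thm. 1 and §7).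

## The data (seam «s7» of the cell's §D chain; every binder is a Γ-reading)
* RINGS `R → S` (`Γ(V) → Γ(U)`), `S₂` (`Γ(W)`), `S₃` (`Γ(W₃)`), all `R`-algebras; COFACES `ψ₁ ψ₂ : S →ₐ[R] S₂` (the two projections; for a torsor
  `act♯`, `snd♯` — CONVENTION `ψ₁ ↔ includeLeft`, `ψ₂ ↔ includeRight` as in ★ `AmitsurDescentData`), `π₁₂ π₁₃ π₂₃ : S₂ →ₐ[R] S₃` (the three edges of
  the triangle: `(1 × act)♯`, `(μ × 1)♯`, `proj₂₃♯`) with the FACE identities `hF₁ : π₁₃ ∘ ψ₁ = π₁₂ ∘ ψ₁` (vertex 1), `hF₂ : π₂₃ ∘ ψ₁ = π₁₂ ∘ ψ₂`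
  (vertex 2); the CODEGENERACY `d : S₂ →ₐ[R] S` (`unitSlice♯`, `u ↦ (e, u)`) with `hd : d ∘ ψ₁ = id`.
* MODULES `P` over `S` (`Γ(U, E)`); `P₁`, `P₂` over `S₂` (`Γ(W, ψ₁^*E)`, `Γ(W, ψ₂^*E)`) with `ψᵢ`-semilinear `jᵢ : P → Pᵢ` (pulled-back sections);
  `Q₂`, `Q₃` over `S₃` (sections over `W₃` of the pull-backs of `E` from vertices 2 and 3) with transitions `t₂ : P₂ → Q₂` (`π₁₂`-semilinear),
  `t₃, t₃' : P₂ → Q₃` (`π₁₃`-, `π₂₃`-semilinear) agreeing on `j₂(P)` (`hk₃`); `ε : P₂ → P` (`d`-semilinear retraction of `j₂`: restriction along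
  the codegeneracy).
* THE DATUM `Φ : P₁ →ₗ[S₂] P₂` (a MORPHISM `ψ₁^*E → ψ₂^*E` read on `W`; no inverse is ever used) and its pull-back `Φ₂₃ : Q₂ →ₗ[S₃] Q₃` pinned on unit
  sections (`hΦ₂₃ : Φ₂₃ (t₂ (j₂ x)) = t₃' (Φ (j₁ x))`); the UNIT `hunit : ε (Φ (j₁ x)) = x` and the COCYCLE `hcocycle : t₃ (Φ (j₁ x)) =
  Φ₂₃ (t₂ (Φ (j₁ x)))` ([StacksProject, Tag 023G] «`φ₀₂ = φ₁₂ ∘ φ₀₁`» evaluated on the pulled-back section of `x`).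
* BASE CHANGE + TORSOR SQUARE, INSTANCE-FREE: the comparison `c₂ : S ⊗_R P → P₂`, `s ⊗ x ↦ ψ₁ s • j₂ x`, BIJECTIVE («`P₂` is `ψ₂^*P` AND
  `S₂ ≅ S ⊗_R S`»), and `c₃ : S ⊗_R S ⊗_R P → Q₃`, `s ⊗ s' ⊗ x ↦ (π₁₂ψ₁ s · π₁₂ψ₂ s') • t₃ (j₂ x)`, INJECTIVE («`Q₃` is the vertex-3 pull-back of
  `P` and `S₃ ≅ S ⊗ S ⊗ S`»).  §2–§3 derive both from `IsBaseChange` in the `letI` dress of ★ `Modules/CechBaseChangeHom.isBaseChange_unitSectionLE`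
  and bijectivity of `Algebra.TensorProduct.lift`.

## Results
* §1 (instance-free core) **`exists_coaction`** — the coaction `θ : P →ₗ[S] S ⊗[R] P` of ★ `FaithfullyFlatModuleDescent`, characterised by
  `c₂ (θ x) = Φ (j₁ x)`, with «`θ x = 1 ⊗ x` iff `Φ (j₁ x) = j₂ x`»; **`counit_of_apply_eq`**, **`coassoc_of_apply_eq`** — its `hε`, `hδ` TOKEN-EXACT
  from the unit, resp. the cocycle data; **`eqLocus_eq`** — the descended module is `LinearMap.eqLocus ((Φ.restrictScalars R) ∘ₗ j₁) j₂ =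
  {x | Φ (j₁ x) = j₂ x}` (the sections on which the datum is the identity); **(D1) `liftBaseChange_bijective`** — for `S` FLAT over `R`,
  `S ⊗_R {x | Φ (j₁ x) = j₂ x} → P`, `s ⊗ n ↦ s • n`, is BIJECTIVE, with the `IsBaseChange` forms `isBaseChange_subtype` and (for any injective
  `j : N → P` with that range) **`isBaseChange_of_range_eq`**; (D2) `apply_j₁_smul_of_mem` — on the descended module the datum is the canonical one;
  **(D3) `exists_linearEquiv_eqLocus`** — for `S` FAITHFULLY flat, uniqueness of the descended module.
* §2 ADAPTERS: **`bijective_lift_smul_of_isBaseChange`** — for `B ⊗_R S ≅ T` (`lift β τ` bijective) and `k : P → Q` a base change along `τ`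
  (`IsBaseChange`, `letI` dress), `B ⊗_R P → Q`, `b ⊗ x ↦ β b • k x` is bijective (`= hc₂` at `β := ψ₁, τ := ψ₂, k := j₂`);
  `comparison₃_eq_lift_smul_assoc_symm`, `injective_comparison₃_of_injective` (`hc₃` from the same adapter at `B := S ⊗_R S`,
  `β := lift (π₁₂∘ψ₁) (π₁₂∘ψ₂)`, `τ := π₁₃∘ψ₂`, `k := t₃ ∘ j₂`); **`isBaseChange_comp_of_isBaseChange`** (`IsBaseChange.comp` in the `letI` dress).
* §3 HEAD **`isBaseChange_of_range_eq_of_isBaseChange`** — (D1) with every base change in `IsBaseChange` dress and the two ring isomorphisms as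
  bijectivity of `Algebra.TensorProduct.lift`: the one `exact` the scheme-side chart file calls.

Mathlib has the categorical statement that extension of scalars along a faithfully flat map is comonadic (`Algebra/Category/ModuleCat/Descent`)
and descends PROPERTIES (`RingTheory/Flat/FaithfullyFlat/Descent`); the module-level effective descent is ★ `FaithfullyFlatModuleDescent`, consumed
here by name (`ModuleDescent.liftBaseChange_bijective`, `ModuleDescent.exists_linearEquiv_eqLocus`).  Written for cell `hodgecm-mathlib` (P6b wave C,
§D `stub_L4B1uD_mumfordLambdaDescent`: descent of the Mumford bundle along the finite flat torsor quotient `1 × π`); HC_CM is proved only modulo the 7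
printed citations until rung 0 closes; nothing here is about HC.

## References
* [SGA1] A. Grothendieck, *SGA 1*, Exp. VIII (descente fidèlement plate), Thm. 1.1 and §1.
* [StacksProject] The Stacks Project, Tag 023G (Definition 35.3.1: descent datum `φ : N ⊗_R S → S ⊗_R N` with cocycle `φ₀₂ = φ₁₂ ∘ φ₀₁`),
  Tag 023M (Lemma 35.3.6), Tag 023N (Proposition 35.3.9: descent for modules is effective, `S ⊗_R H⁰ ≅ N`).
* [GortzWedhorn2020] U. Görtz, T. Wedhorn, *Algebraic Geometry I*, 2nd ed. (2020), Prop. 14.66, Thm. 14.68 and (14.14.2) (descent data on the Čech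
  nerve, pp. 454–458).
* [MumfordAV1970] D. Mumford, *Abelian Varieties* (1970), §12 Thm. 1 (p. 111–112: `G × X ≅ X ×_Y X` and `M ↦ M^{G}` for quasi-coherent modules).
-/

set_option autoImplicit false

open TensorProduct

namespace Literature.RingTheory.Flat.ModuleDescentData

universe u v v₂ v₃ w w₁ w₂ w₃ w₄ w'

/-! ## §1 The comparison `c₂ : S ⊗_R P → P₂` and the coaction `θ` -/

section Core

variable {R : Type u} {S : Type v} {S₂ : Type v₂} {S₃ : Type v₃}
  [CommRing R] [CommRing S] [CommRing S₂] [CommRing S₃] [Algebra R S] [Algebra R S₂] [Algebra R S₃]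
  (ψ₁ ψ₂ : S →ₐ[R] S₂) (π₁₂ π₁₃ π₂₃ : S₂ →ₐ[R] S₃) (d : S₂ →ₐ[R] S)
  {P : Type w} [AddCommGroup P] [Module R P] [Module S P] [IsScalarTower R S P]
  {P₁ : Type w₁} [AddCommGroup P₁] [Module R P₁] [Module S₂ P₁] [IsScalarTower R S₂ P₁]
  {P₂ : Type w₂} [AddCommGroup P₂] [Module R P₂] [Module S₂ P₂] [IsScalarTower R S₂ P₂]
  {Q₂ : Type w₃} [AddCommGroup Q₂] [Module R Q₂] [Module S₃ Q₂]
  {Q₃ : Type w₄} [AddCommGroup Q₃] [Module R Q₃] [Module S₃ Q₃] [IsScalarTower R S₃ Q₃]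
  (j₁ : P →ₗ[R] P₁) (j₂ : P →ₗ[R] P₂) (Φ : P₁ →ₗ[S₂] P₂) (ε : P₂ →ₗ[R] P)
  (t₂ : P₂ →ₗ[R] Q₂) (t₃ t₃' : P₂ →ₗ[R] Q₃) (Φ₂₃ : Q₂ →ₗ[S₃] Q₃)

omit [Module S P] [IsScalarTower R S P] in
/-- The comparison `c₂ : S ⊗_R P → P₂` on pure tensors: `s ⊗ x ↦ ψ₁ s • j₂ x`. [cite: StacksProject, Tag 023G] -/
theorem comparison_tmul (s : S) (x : P) :
    TensorProduct.lift (((Algebra.lsmul R R P₂ : S₂ →ₐ[R] Module.End R P₂).toLinearMap ∘ₗ ψ₁.toLinearMap).compl₂ j₂)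
      (s ⊗ₜ[R] x) = ψ₁ s • j₂ x := by
  simp [TensorProduct.lift.tmul, LinearMap.compl₂_apply]

omit [Module S P] [IsScalarTower R S P] in
/-- `c₂` intertwines the `S`-action on the left factor of `S ⊗_R P` with the `ψ₁`-twisted action on `P₂`. [cite: StacksProject, Tag 023G] -/
theorem comparison_smul (s : S) (z : S ⊗[R] P) :
    TensorProduct.lift (((Algebra.lsmul R R P₂ : S₂ →ₐ[R] Module.End R P₂).toLinearMap ∘ₗ ψ₁.toLinearMap).compl₂ j₂) (s • z) =
      ψ₁ s • TensorProduct.lift (((Algebra.lsmul R R P₂ : S₂ →ₐ[R] Module.End R P₂).toLinearMap ∘ₗ ψ₁.toLinearMap).compl₂ j₂) z := by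
  induction z using TensorProduct.induction_on with
  | zero => simp
  | tmul s' x => rw [TensorProduct.smul_tmul', comparison_tmul, comparison_tmul, smul_eq_mul, map_mul, mul_smul]
  | add y z hy hz => rw [smul_add, map_add, map_add, hy, hz, smul_add]

omit [IsScalarTower R S₂ P₁] [IsScalarTower R S P] in
/-- **(D0) THE COACTION.**  From the instance-free chart data — `j₁ : P → P₁` `ψ₁`-semilinear, the datum `Φ : P₁ → P₂` `S₂`-linear, and the
comparison `c₂ : S ⊗_R P → P₂`, `s ⊗ x ↦ ψ₁ s • j₂ x`, BIJECTIVE («`P₂` is the base change of `P` along `ψ₂` and `S₂ ≅ S ⊗_R S`») — the descent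
datum in the comodule form of ★ `Flat/FaithfullyFlatModuleDescent`: an `S`-linear `θ : P → S ⊗_R P` CHARACTERISED by `c₂ (θ x) = Φ (j₁ x)`, whose
coinvariants `{x | θ x = 1 ⊗ x}` are exactly `{x | Φ (j₁ x) = j₂ x}` ([StacksProject, Tag 023G]/[Tag 023N]: `θ x = φ (x ⊗ 1)` read through the
identification `S ⊗_R P ≅ P₂`). [cite: StacksProject, Tag 023G] [cite: StacksProject, Tag 023N] -/
theorem exists_coaction
    (hj₁ : ∀ (s : S) (x : P), j₁ (s • x) = ψ₁ s • j₁ x)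
    (hc₂ : Function.Bijective
      (TensorProduct.lift (((Algebra.lsmul R R P₂ : S₂ →ₐ[R] Module.End R P₂).toLinearMap ∘ₗ ψ₁.toLinearMap).compl₂ j₂))) :
    ∃ θ : P →ₗ[S] S ⊗[R] P,
      (∀ x : P, TensorProduct.lift (((Algebra.lsmul R R P₂ : S₂ →ₐ[R] Module.End R P₂).toLinearMap ∘ₗ ψ₁.toLinearMap).compl₂ j₂)
        (θ x) = Φ (j₁ x)) ∧
      (∀ x : P, θ x = 1 ⊗ₜ[R] x ↔ Φ (j₁ x) = j₂ x) := by
  let e : S ⊗[R] P ≃ₗ[R] P₂ := LinearEquiv.ofBijective _ hc₂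
  have he : ∀ z, e z = TensorProduct.lift (((Algebra.lsmul R R P₂ : S₂ →ₐ[R] Module.End R P₂).toLinearMap ∘ₗ
      ψ₁.toLinearMap).compl₂ j₂) z := fun z => rfl
  let θ : P →ₗ[S] S ⊗[R] P :=
    { toFun := fun x => e.symm (Φ (j₁ x))
      map_add' := fun x y => by simp only [map_add]
      map_smul' := fun s x => by
        apply e.injective
        rw [RingHom.id_apply, LinearEquiv.apply_symm_apply, he, comparison_smul, ← he, LinearEquiv.apply_symm_apply, hj₁,
          LinearMap.map_smul] }
  have hθ : ∀ x : P, TensorProduct.lift (((Algebra.lsmul R R P₂ : S₂ →ₐ[R] Module.End R P₂).toLinearMap ∘ₗ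
      ψ₁.toLinearMap).compl₂ j₂) (θ x) = Φ (j₁ x) := fun x => by
    change e (e.symm (Φ (j₁ x))) = _
    exact e.apply_symm_apply _
  refine ⟨θ, hθ, fun x => ⟨fun h => ?_, fun h => ?_⟩⟩
  · rw [← hθ x, h, comparison_tmul, map_one, one_smul]
  · apply e.injective
    rw [he, he, hθ, comparison_tmul, map_one, one_smul, h]

/-- `ε ∘ c₂` is the multiplication `s ⊗ x ↦ s • x` (unit-slice restriction after pull-back is the identity). [cite: StacksProject, Tag 023G] -/
theorem counit_comparison
    (hd : ∀ s : S, d (ψ₁ s) = s) (hε : ∀ (s : S₂) (y : P₂), ε (s • y) = d s • ε y) (hεj : ∀ x : P, ε (j₂ x) = x)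
    (z : S ⊗[R] P) :
    ε (TensorProduct.lift (((Algebra.lsmul R R P₂ : S₂ →ₐ[R] Module.End R P₂).toLinearMap ∘ₗ ψ₁.toLinearMap).compl₂ j₂) z) =
      (LinearMap.id : P →ₗ[R] P).liftBaseChange S z := by
  induction z using TensorProduct.induction_on with
  | zero => simp
  | tmul s x => rw [comparison_tmul, hε, hd, hεj, LinearMap.liftBaseChange_tmul, LinearMap.id_apply]
  | add y z hy hz => rw [map_add, map_add, map_add, hy, hz]

omit [IsScalarTower R S₂ P₁] in
/-- **(D0-ε) COUNIT.**  If the datum restricts to the identity along the codegeneracy (`ε (Φ (j₁ x)) = x`, with `ε : P₂ → P` a `d`-semilinear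
retraction of `j₂` and `d ∘ ψ₁ = id`), then any `θ` with `c₂ (θ x) = Φ (j₁ x)` is COUNITAL in the token form of ★ `FaithfullyFlatModuleDescent`:
`(s ⊗ x ↦ s • x) (θ x) = x`. [cite: StacksProject, Tag 023G] -/
theorem counit_of_apply_eq
    (hd : ∀ s : S, d (ψ₁ s) = s) (hε : ∀ (s : S₂) (y : P₂), ε (s • y) = d s • ε y) (hεj : ∀ x : P, ε (j₂ x) = x)
    (hunit : ∀ x : P, ε (Φ (j₁ x)) = x)
    (θ : P →ₗ[S] S ⊗[R] P)
    (hθ : ∀ x : P, TensorProduct.lift (((Algebra.lsmul R R P₂ : S₂ →ₐ[R] Module.End R P₂).toLinearMap ∘ₗ ψ₁.toLinearMap).compl₂ j₂)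
        (θ x) = Φ (j₁ x)) :
    ∀ x : P, (LinearMap.id : P →ₗ[R] P).liftBaseChange S (θ x) = x := fun x => by
  rw [← counit_comparison ψ₁ d j₂ ε hd hε hεj, hθ, hunit]

omit [Module S P] [IsScalarTower R S P] [Module S₂ P₂] [IsScalarTower R S₂ P₂] in
/-- The inner comparison `c₃' : S ⊗_R P → Q₃`, `s' ⊗ x ↦ π₁₂ (ψ₂ s') • t₃ (j₂ x)`, on pure tensors. [cite: StacksProject, Tag 023G] -/
theorem comparison₃'_tmul (s' : S) (x : P) :
    TensorProduct.lift (((Algebra.lsmul R R Q₃ : S₃ →ₐ[R] Module.End R Q₃).toLinearMap ∘ₗ (π₁₂.comp ψ₂).toLinearMap).compl₂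
      (t₃ ∘ₗ j₂)) (s' ⊗ₜ[R] x) = π₁₂ (ψ₂ s') • t₃ (j₂ x) := by
  simp [TensorProduct.lift.tmul, LinearMap.compl₂_apply]

omit [Module S P] [IsScalarTower R S P] [Module S₂ P₂] [IsScalarTower R S₂ P₂] in
/-- The comparison `c₃ : S ⊗_R (S ⊗_R P) → Q₃` on `s ⊗ z`: `π₁₂ (ψ₁ s) • c₃' z`. [cite: StacksProject, Tag 023G] -/
theorem comparison₃_tmul (s : S) (z : S ⊗[R] P) :
    TensorProduct.lift (((Algebra.lsmul R R Q₃ : S₃ →ₐ[R] Module.End R Q₃).toLinearMap ∘ₗ (π₁₂.comp ψ₁).toLinearMap).compl₂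
      (TensorProduct.lift (((Algebra.lsmul R R Q₃ : S₃ →ₐ[R] Module.End R Q₃).toLinearMap ∘ₗ (π₁₂.comp ψ₂).toLinearMap).compl₂
        (t₃ ∘ₗ j₂)))) (s ⊗ₜ[R] z) =
      π₁₂ (ψ₁ s) • TensorProduct.lift (((Algebra.lsmul R R Q₃ : S₃ →ₐ[R] Module.End R Q₃).toLinearMap ∘ₗ
        (π₁₂.comp ψ₂).toLinearMap).compl₂ (t₃ ∘ₗ j₂)) z := by
  simp [TensorProduct.lift.tmul, LinearMap.compl₂_apply]


omit [Module S P] [IsScalarTower R S P] [Module S₂ P₂] [IsScalarTower R S₂ P₂] in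
/-- `c₃` is the one-step comparison `(S ⊗_R S) ⊗_R P → Q₃`, `(s ⊗ s') ⊗ x ↦ (π₁₂ψ₁ s · π₁₂ψ₂ s') • t₃ (j₂ x)` (the shape of the §2 adapter with
`B := S ⊗_R S`, `β := lift (π₁₂ ∘ ψ₁) (π₁₂ ∘ ψ₂)`, `k := t₃ ∘ j₂`) after the associator. [cite: StacksProject, Tag 023G] -/
theorem comparison₃_eq_lift_smul_assoc_symm (z : S ⊗[R] (S ⊗[R] P)) :
    TensorProduct.lift (((Algebra.lsmul R R Q₃ : S₃ →ₐ[R] Module.End R Q₃).toLinearMap ∘ₗ (π₁₂.comp ψ₁).toLinearMap).compl₂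
      (TensorProduct.lift (((Algebra.lsmul R R Q₃ : S₃ →ₐ[R] Module.End R Q₃).toLinearMap ∘ₗ (π₁₂.comp ψ₂).toLinearMap).compl₂
        (t₃ ∘ₗ j₂)))) z =
      TensorProduct.lift (((Algebra.lsmul R R Q₃ : S₃ →ₐ[R] Module.End R Q₃).toLinearMap ∘ₗ
        (Algebra.TensorProduct.lift (π₁₂.comp ψ₁) (π₁₂.comp ψ₂) (fun _ _ => Commute.all _ _)).toLinearMap).compl₂ (t₃ ∘ₗ j₂))
        ((TensorProduct.assoc R S S P).symm z) := by
  induction z using TensorProduct.induction_on with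
  | zero => simp
  | tmul s w =>
      induction w using TensorProduct.induction_on with
      | zero => simp
      | tmul s' x =>
          rw [TensorProduct.assoc_symm_tmul, comparison₃_tmul, comparison₃'_tmul]
          simp [TensorProduct.lift.tmul, LinearMap.compl₂_apply, Algebra.TensorProduct.lift_tmul]
      | add y z hy hz => rw [TensorProduct.tmul_add, map_add, map_add, map_add, hy, hz]
  | add y z hy hz => rw [map_add, map_add, map_add, hy, hz]

omit [Module S P] [IsScalarTower R S P] [Module S₂ P₂] [IsScalarTower R S₂ P₂] in
/-- Hence `c₃` is injective as soon as the one-step comparison `(S ⊗_R S) ⊗_R P → Q₃` is (e.g. bijective, by the §2 adapter with `B := S ⊗_R S`: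
«`Q₃` is the base change of `P` along the third vertex and `S₃ ≅ S ⊗ S ⊗ S`»). [cite: StacksProject, Tag 023G] -/
theorem injective_comparison₃_of_injective
    (h : Function.Injective (TensorProduct.lift (((Algebra.lsmul R R Q₃ : S₃ →ₐ[R] Module.End R Q₃).toLinearMap ∘ₗ
        (Algebra.TensorProduct.lift (π₁₂.comp ψ₁) (π₁₂.comp ψ₂) (fun _ _ => Commute.all _ _)).toLinearMap).compl₂ (t₃ ∘ₗ j₂)))) :
    Function.Injective
      (TensorProduct.lift (((Algebra.lsmul R R Q₃ : S₃ →ₐ[R] Module.End R Q₃).toLinearMap ∘ₗ (π₁₂.comp ψ₁).toLinearMap).compl₂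
        (TensorProduct.lift (((Algebra.lsmul R R Q₃ : S₃ →ₐ[R] Module.End R Q₃).toLinearMap ∘ₗ (π₁₂.comp ψ₂).toLinearMap).compl₂
          (t₃ ∘ₗ j₂))))) := by
  intro y z hyz
  rw [comparison₃_eq_lift_smul_assoc_symm, comparison₃_eq_lift_smul_assoc_symm] at hyz
  exact (TensorProduct.assoc R S S P).symm.injective (h hyz)

omit [IsScalarTower R S₂ P₁] in
/-- **(D0-δ) COCYCLE.**  The level-3 data of the s7 block (transitions `t₂, t₃, t₃'` over the three edge maps `π₁₂, π₁₃, π₂₃`, the two face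
identities, the pulled-back datum `Φ₂₃` pinned on unit sections, the COCYCLE `t₃ (Φ (j₁ x)) = Φ₂₃ (t₂ (Φ (j₁ x)))`, and the injective
comparison `c₃ : S ⊗_R S ⊗_R P → Q₃`) make any `θ` with `c₂ (θ x) = Φ (j₁ x)` COASSOCIATIVE in the token form of ★ `FaithfullyFlatModuleDescent`:
`(S ⊗ θ) (θ x) = (S ⊗ (1 ⊗ –)) (θ x)` ([StacksProject, Tag 023G]: the cocycle `φ₀₂ = φ₁₂ ∘ φ₀₁` on `x ⊗ 1 ⊗ 1`, read through `S ⊗ S ⊗ P ↪ Q₃`).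
[cite: StacksProject, Tag 023G] -/
theorem coassoc_of_apply_eq
    (hF₁ : ∀ s : S, π₁₃ (ψ₁ s) = π₁₂ (ψ₁ s)) (hF₂ : ∀ s : S, π₂₃ (ψ₁ s) = π₁₂ (ψ₂ s))
    (ht₂ : ∀ (s : S₂) (y : P₂), t₂ (s • y) = π₁₂ s • t₂ y) (ht₃ : ∀ (s : S₂) (y : P₂), t₃ (s • y) = π₁₃ s • t₃ y)
    (ht₃' : ∀ (s : S₂) (y : P₂), t₃' (s • y) = π₂₃ s • t₃' y) (hk₃ : ∀ x : P, t₃ (j₂ x) = t₃' (j₂ x))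
    (hΦ₂₃ : ∀ x : P, Φ₂₃ (t₂ (j₂ x)) = t₃' (Φ (j₁ x)))
    (hcocycle : ∀ x : P, t₃ (Φ (j₁ x)) = Φ₂₃ (t₂ (Φ (j₁ x))))
    (hc₃ : Function.Injective
      (TensorProduct.lift (((Algebra.lsmul R R Q₃ : S₃ →ₐ[R] Module.End R Q₃).toLinearMap ∘ₗ (π₁₂.comp ψ₁).toLinearMap).compl₂
        (TensorProduct.lift (((Algebra.lsmul R R Q₃ : S₃ →ₐ[R] Module.End R Q₃).toLinearMap ∘ₗ (π₁₂.comp ψ₂).toLinearMap).compl₂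
          (t₃ ∘ₗ j₂))))))
    (θ : P →ₗ[S] S ⊗[R] P)
    (hθ : ∀ x : P, TensorProduct.lift (((Algebra.lsmul R R P₂ : S₂ →ₐ[R] Module.End R P₂).toLinearMap ∘ₗ ψ₁.toLinearMap).compl₂ j₂)
        (θ x) = Φ (j₁ x)) :
    ∀ x : P, LinearMap.lTensor S (θ.restrictScalars R) (θ x) = LinearMap.lTensor S (TensorProduct.mk R S P 1) (θ x) := by
  -- Claim A: `c₃ ∘ (S ⊗ (1 ⊗ –)) = t₃ ∘ c₂`
  have hA : ∀ z : S ⊗[R] P,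
      TensorProduct.lift (((Algebra.lsmul R R Q₃ : S₃ →ₐ[R] Module.End R Q₃).toLinearMap ∘ₗ (π₁₂.comp ψ₁).toLinearMap).compl₂
        (TensorProduct.lift (((Algebra.lsmul R R Q₃ : S₃ →ₐ[R] Module.End R Q₃).toLinearMap ∘ₗ (π₁₂.comp ψ₂).toLinearMap).compl₂
          (t₃ ∘ₗ j₂)))) (LinearMap.lTensor S (TensorProduct.mk R S P 1) z) =
      t₃ (TensorProduct.lift (((Algebra.lsmul R R P₂ : S₂ →ₐ[R] Module.End R P₂).toLinearMap ∘ₗ ψ₁.toLinearMap).compl₂ j₂) z) := by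
    intro z
    induction z using TensorProduct.induction_on with
    | zero => simp
    | tmul s x =>
        rw [LinearMap.lTensor_tmul, TensorProduct.mk_apply, comparison₃_tmul, comparison₃'_tmul, comparison_tmul, map_one, map_one,
          one_smul, ht₃, hF₁]
    | add y z hy hz => rw [map_add, map_add, hy, hz, map_add, map_add]
  -- Claim B': `c₃' = t₃' ∘ c₂`
  have hB' : ∀ z : S ⊗[R] P,
      TensorProduct.lift (((Algebra.lsmul R R Q₃ : S₃ →ₐ[R] Module.End R Q₃).toLinearMap ∘ₗ (π₁₂.comp ψ₂).toLinearMap).compl₂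
        (t₃ ∘ₗ j₂)) z =
      t₃' (TensorProduct.lift (((Algebra.lsmul R R P₂ : S₂ →ₐ[R] Module.End R P₂).toLinearMap ∘ₗ ψ₁.toLinearMap).compl₂ j₂) z) := by
    intro z
    induction z using TensorProduct.induction_on with
    | zero => simp
    | tmul s' x => rw [comparison₃'_tmul, comparison_tmul, ht₃', hF₂, hk₃]
    | add y z hy hz => rw [map_add, hy, hz, map_add, map_add]
  -- Claim B: `c₃ ∘ (S ⊗ θ) = Φ₂₃ ∘ t₂ ∘ c₂`
  have hB : ∀ z : S ⊗[R] P,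
      TensorProduct.lift (((Algebra.lsmul R R Q₃ : S₃ →ₐ[R] Module.End R Q₃).toLinearMap ∘ₗ (π₁₂.comp ψ₁).toLinearMap).compl₂
        (TensorProduct.lift (((Algebra.lsmul R R Q₃ : S₃ →ₐ[R] Module.End R Q₃).toLinearMap ∘ₗ (π₁₂.comp ψ₂).toLinearMap).compl₂
          (t₃ ∘ₗ j₂)))) (LinearMap.lTensor S (θ.restrictScalars R) z) =
      Φ₂₃ (t₂ (TensorProduct.lift (((Algebra.lsmul R R P₂ : S₂ →ₐ[R] Module.End R P₂).toLinearMap ∘ₗ ψ₁.toLinearMap).compl₂ j₂) z)) := by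
    intro z
    induction z using TensorProduct.induction_on with
    | zero => simp
    | tmul s x =>
        rw [LinearMap.lTensor_tmul, LinearMap.restrictScalars_apply, comparison₃_tmul, hB', hθ, ← hΦ₂₃, comparison_tmul, ht₂,
          LinearMap.map_smul]
    | add y z hy hz => rw [map_add, map_add, hy, hz, map_add, map_add, map_add]
  intro x
  apply hc₃
  rw [hB, hA, hθ]
  exact (hcocycle x).symm

/-- **(D0-N) THE DESCENDED MODULE** of `θ` is `{x | Φ (j₁ x) = j₂ x}` — the sections on which the datum agrees with the identity (the comodule
coinvariants; [StacksProject, Tag 023N]'s `H⁰`), as an equality of `R`-submodules `eqLocus`. [cite: StacksProject, Tag 023N] -/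
theorem eqLocus_eq (θ : P →ₗ[S] S ⊗[R] P)
    (hθN : ∀ x : P, θ x = 1 ⊗ₜ[R] x ↔ Φ (j₁ x) = j₂ x) :
    LinearMap.eqLocus (θ.restrictScalars R) (TensorProduct.mk R S P 1) =
      LinearMap.eqLocus ((Φ.restrictScalars R) ∘ₗ j₁) j₂ := by
  ext x
  simp only [LinearMap.mem_eqLocus, LinearMap.restrictScalars_apply, TensorProduct.mk_apply, LinearMap.coe_comp,
    Function.comp_apply]
  exact hθN x

/-- **(D1) EFFECTIVITY OF DESCENT FOR MODULES, base-change data form** ([SGA1] Exp. VIII Thm. 1.1; [StacksProject, Tag 023N];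
[GortzWedhorn2020] Thm. 14.68): for `S` FLAT over `R` and the full s7 block (datum `Φ`, unit, cocycle, the comparisons `c₂` bijective and `c₃`
injective), the module `N := {x ∈ P | Φ (j₁ x) = j₂ x}` DESCENDS `P`: the comparison `S ⊗_R N → P`, `s ⊗ n ↦ s • n`, is BIJECTIVE.  (★
`ModuleDescent.liftBaseChange_bijective` for the coaction of (D0).) [cite: SGA1, Exp. VIII Thm. 1.1] [cite: StacksProject, Tag 023N]
[cite: GortzWedhorn2020, Thm. 14.68] -/
theorem liftBaseChange_bijective [Module.Flat R S]
    (hj₁ : ∀ (s : S) (x : P), j₁ (s • x) = ψ₁ s • j₁ x)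
    (hc₂ : Function.Bijective
      (TensorProduct.lift (((Algebra.lsmul R R P₂ : S₂ →ₐ[R] Module.End R P₂).toLinearMap ∘ₗ ψ₁.toLinearMap).compl₂ j₂)))
    (hd : ∀ s : S, d (ψ₁ s) = s) (hε : ∀ (s : S₂) (y : P₂), ε (s • y) = d s • ε y) (hεj : ∀ x : P, ε (j₂ x) = x)
    (hunit : ∀ x : P, ε (Φ (j₁ x)) = x)
    (hF₁ : ∀ s : S, π₁₃ (ψ₁ s) = π₁₂ (ψ₁ s)) (hF₂ : ∀ s : S, π₂₃ (ψ₁ s) = π₁₂ (ψ₂ s))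
    (ht₂ : ∀ (s : S₂) (y : P₂), t₂ (s • y) = π₁₂ s • t₂ y) (ht₃ : ∀ (s : S₂) (y : P₂), t₃ (s • y) = π₁₃ s • t₃ y)
    (ht₃' : ∀ (s : S₂) (y : P₂), t₃' (s • y) = π₂₃ s • t₃' y) (hk₃ : ∀ x : P, t₃ (j₂ x) = t₃' (j₂ x))
    (hΦ₂₃ : ∀ x : P, Φ₂₃ (t₂ (j₂ x)) = t₃' (Φ (j₁ x)))
    (hcocycle : ∀ x : P, t₃ (Φ (j₁ x)) = Φ₂₃ (t₂ (Φ (j₁ x))))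
    (hc₃ : Function.Injective
      (TensorProduct.lift (((Algebra.lsmul R R Q₃ : S₃ →ₐ[R] Module.End R Q₃).toLinearMap ∘ₗ (π₁₂.comp ψ₁).toLinearMap).compl₂
        (TensorProduct.lift (((Algebra.lsmul R R Q₃ : S₃ →ₐ[R] Module.End R Q₃).toLinearMap ∘ₗ (π₁₂.comp ψ₂).toLinearMap).compl₂
          (t₃ ∘ₗ j₂)))))) :
    Function.Bijective ((LinearMap.eqLocus ((Φ.restrictScalars R) ∘ₗ j₁) j₂).subtype.liftBaseChange S) := by
  obtain ⟨θ, hθ, hθN⟩ := exists_coaction ψ₁ j₁ j₂ Φ hj₁ hc₂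
  have h := ModuleDescent.liftBaseChange_bijective R S θ
    (counit_of_apply_eq ψ₁ d j₁ j₂ Φ ε hd hε hεj hunit θ hθ)
    (coassoc_of_apply_eq ψ₁ ψ₂ π₁₂ π₁₃ π₂₃ j₁ j₂ Φ t₂ t₃ t₃' Φ₂₃ hF₁ hF₂ ht₂ ht₃ ht₃' hk₃ hΦ₂₃ hcocycle hc₃ θ hθ)
  rw [eqLocus_eq j₁ j₂ Φ θ hθN] at h
  exact h

/-- `IsBaseChange` form of (D1) (the currency of ★ `AmitsurDescentData` ∕ ★ `CechBaseChangeHom`): the inclusion `{x | Φ (j₁ x) = j₂ x} ↪ P`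
exhibits `P` as the base change `S ⊗_R {x | Φ (j₁ x) = j₂ x}`. [cite: StacksProject, Tag 023N] [cite: GortzWedhorn2020, Thm. 14.68] -/
theorem isBaseChange_subtype [Module.Flat R S]
    (hj₁ : ∀ (s : S) (x : P), j₁ (s • x) = ψ₁ s • j₁ x)
    (hc₂ : Function.Bijective
      (TensorProduct.lift (((Algebra.lsmul R R P₂ : S₂ →ₐ[R] Module.End R P₂).toLinearMap ∘ₗ ψ₁.toLinearMap).compl₂ j₂)))
    (hd : ∀ s : S, d (ψ₁ s) = s) (hε : ∀ (s : S₂) (y : P₂), ε (s • y) = d s • ε y) (hεj : ∀ x : P, ε (j₂ x) = x)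
    (hunit : ∀ x : P, ε (Φ (j₁ x)) = x)
    (hF₁ : ∀ s : S, π₁₃ (ψ₁ s) = π₁₂ (ψ₁ s)) (hF₂ : ∀ s : S, π₂₃ (ψ₁ s) = π₁₂ (ψ₂ s))
    (ht₂ : ∀ (s : S₂) (y : P₂), t₂ (s • y) = π₁₂ s • t₂ y) (ht₃ : ∀ (s : S₂) (y : P₂), t₃ (s • y) = π₁₃ s • t₃ y)
    (ht₃' : ∀ (s : S₂) (y : P₂), t₃' (s • y) = π₂₃ s • t₃' y) (hk₃ : ∀ x : P, t₃ (j₂ x) = t₃' (j₂ x))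
    (hΦ₂₃ : ∀ x : P, Φ₂₃ (t₂ (j₂ x)) = t₃' (Φ (j₁ x)))
    (hcocycle : ∀ x : P, t₃ (Φ (j₁ x)) = Φ₂₃ (t₂ (Φ (j₁ x))))
    (hc₃ : Function.Injective
      (TensorProduct.lift (((Algebra.lsmul R R Q₃ : S₃ →ₐ[R] Module.End R Q₃).toLinearMap ∘ₗ (π₁₂.comp ψ₁).toLinearMap).compl₂
        (TensorProduct.lift (((Algebra.lsmul R R Q₃ : S₃ →ₐ[R] Module.End R Q₃).toLinearMap ∘ₗ (π₁₂.comp ψ₂).toLinearMap).compl₂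
          (t₃ ∘ₗ j₂)))))) :
    IsBaseChange S (LinearMap.eqLocus ((Φ.restrictScalars R) ∘ₗ j₁) j₂).subtype :=
  IsBaseChange.of_equiv (LinearEquiv.ofBijective _ (liftBaseChange_bijective ψ₁ ψ₂ π₁₂ π₁₃ π₂₃ d j₁ j₂ Φ ε t₂ t₃ t₃' Φ₂₃ hj₁ hc₂
    hd hε hεj hunit hF₁ hF₂ ht₂ ht₃ ht₃' hk₃ hΦ₂₃ hcocycle hc₃)) fun n => by simp


/-- **(D1), RANGE FORM** (the shape of the scheme-side HEAD `TorsorQuotientModuleChart.isBaseChange_of_range_eq_equaliser`): any `R`-linear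
`j : N → P` whose range is EXACTLY `{x | Φ (j₁ x) = j₂ x}` and which is injective exhibits `P` as the base change `S ⊗_R N` (`S` flat over `R`).
[cite: StacksProject, Tag 023N] [cite: GortzWedhorn2020, Thm. 14.68] -/
theorem isBaseChange_of_range_eq [Module.Flat R S]
    (hj₁ : ∀ (s : S) (x : P), j₁ (s • x) = ψ₁ s • j₁ x)
    (hc₂ : Function.Bijective
      (TensorProduct.lift (((Algebra.lsmul R R P₂ : S₂ →ₐ[R] Module.End R P₂).toLinearMap ∘ₗ ψ₁.toLinearMap).compl₂ j₂)))
    (hd : ∀ s : S, d (ψ₁ s) = s) (hε : ∀ (s : S₂) (y : P₂), ε (s • y) = d s • ε y) (hεj : ∀ x : P, ε (j₂ x) = x)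
    (hunit : ∀ x : P, ε (Φ (j₁ x)) = x)
    (hF₁ : ∀ s : S, π₁₃ (ψ₁ s) = π₁₂ (ψ₁ s)) (hF₂ : ∀ s : S, π₂₃ (ψ₁ s) = π₁₂ (ψ₂ s))
    (ht₂ : ∀ (s : S₂) (y : P₂), t₂ (s • y) = π₁₂ s • t₂ y) (ht₃ : ∀ (s : S₂) (y : P₂), t₃ (s • y) = π₁₃ s • t₃ y)
    (ht₃' : ∀ (s : S₂) (y : P₂), t₃' (s • y) = π₂₃ s • t₃' y) (hk₃ : ∀ x : P, t₃ (j₂ x) = t₃' (j₂ x))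
    (hΦ₂₃ : ∀ x : P, Φ₂₃ (t₂ (j₂ x)) = t₃' (Φ (j₁ x)))
    (hcocycle : ∀ x : P, t₃ (Φ (j₁ x)) = Φ₂₃ (t₂ (Φ (j₁ x))))
    (hc₃ : Function.Injective
      (TensorProduct.lift (((Algebra.lsmul R R Q₃ : S₃ →ₐ[R] Module.End R Q₃).toLinearMap ∘ₗ (π₁₂.comp ψ₁).toLinearMap).compl₂
        (TensorProduct.lift (((Algebra.lsmul R R Q₃ : S₃ →ₐ[R] Module.End R Q₃).toLinearMap ∘ₗ (π₁₂.comp ψ₂).toLinearMap).compl₂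
          (t₃ ∘ₗ j₂))))))
    {N : Type w'} [AddCommGroup N] [Module R N] (j : N →ₗ[R] P) (hjinj : Function.Injective j)
    (hj : ∀ x : P, x ∈ Set.range j ↔ Φ (j₁ x) = j₂ x) :
    IsBaseChange S j := by
  have hrange : LinearMap.range j = LinearMap.eqLocus ((Φ.restrictScalars R) ∘ₗ j₁) j₂ := by
    ext x
    rw [LinearMap.mem_range, ← Set.mem_range, hj x, LinearMap.mem_eqLocus]
    rfl
  -- `N ≃ range j = eqLocus`, and the inclusion of `eqLocus` is a base change by (D1)
  let e : N ≃ₗ[R] LinearMap.eqLocus ((Φ.restrictScalars R) ∘ₗ j₁) j₂ :=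
    (LinearEquiv.ofInjective j hjinj).trans (LinearEquiv.ofEq _ _ hrange)
  have hcomp : (LinearMap.eqLocus ((Φ.restrictScalars R) ∘ₗ j₁) j₂).subtype ∘ₗ e.toLinearMap = j := by
    ext n
    rfl
  rw [← hcomp]
  exact (isBaseChange_subtype ψ₁ ψ₂ π₁₂ π₁₃ π₂₃ d j₁ j₂ Φ ε t₂ t₃ t₃' Φ₂₃ hj₁ hc₂ hd hε hεj hunit hF₁ hF₂ ht₂ ht₃ ht₃' hk₃ hΦ₂₃
    hcocycle hc₃).comp_equiv e

omit [IsScalarTower R S P] in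
/-- **(D2) the datum is the CANONICAL one on the descended module** (hypothesis-free): for `n ∈ {x | Φ (j₁ x) = j₂ x}` and `s ∈ S`,
`Φ (j₁ (s • n)) = ψ₁ s • j₂ n` — i.e. under `S ⊗_R N ≅ P` the datum reads `s ⊗ n ↦ ψ₁ s • j₂ n`, the canonical datum of a base change
([StacksProject, Tag 023N] «the descent datum is the canonical one»). [cite: StacksProject, Tag 023N] -/
theorem apply_j₁_smul_of_mem (hj₁ : ∀ (s : S) (x : P), j₁ (s • x) = ψ₁ s • j₁ x) (s : S) {n : P}
    (hn : n ∈ LinearMap.eqLocus ((Φ.restrictScalars R) ∘ₗ j₁) j₂) : Φ (j₁ (s • n)) = ψ₁ s • j₂ n := by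
  rw [LinearMap.mem_eqLocus, LinearMap.coe_comp, Function.comp_apply, LinearMap.restrictScalars_apply] at hn
  rw [hj₁, LinearMap.map_smul, hn]

/-- **(D3) UNIQUENESS of the descended module, data form** ([StacksProject, Tag 023N]; [GortzWedhorn2020] Thm. 14.68): for `S` FAITHFULLY flat
over `R`, an `R`-module `N′` with an `S`-linear bijection `e : S ⊗_R N′ → P` under which the canonical datum becomes `Φ` — i.e. every
`e (1 ⊗ n)` satisfies `Φ (j₁ (e (1 ⊗ n))) = j₂ (e (1 ⊗ n))` — is `R`-isomorphic to `{x | Φ (j₁ x) = j₂ x}` by `n ↦ e (1 ⊗ n)`.  (★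
`ModuleDescent.exists_linearEquiv_eqLocus` for the coaction of (D0).) [cite: StacksProject, Tag 023N] [cite: GortzWedhorn2020, Thm. 14.68] -/
theorem exists_linearEquiv_eqLocus [Module.FaithfullyFlat R S]
    (hj₁ : ∀ (s : S) (x : P), j₁ (s • x) = ψ₁ s • j₁ x)
    (hc₂ : Function.Bijective
      (TensorProduct.lift (((Algebra.lsmul R R P₂ : S₂ →ₐ[R] Module.End R P₂).toLinearMap ∘ₗ ψ₁.toLinearMap).compl₂ j₂)))
    {N' : Type w'} [AddCommGroup N'] [Module R N'] (e : S ⊗[R] N' →ₗ[S] P) (hbij : Function.Bijective e)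
    (he : ∀ n : N', Φ (j₁ (e (1 ⊗ₜ[R] n))) = j₂ (e (1 ⊗ₜ[R] n))) :
    ∃ f : N' ≃ₗ[R] LinearMap.eqLocus ((Φ.restrictScalars R) ∘ₗ j₁) j₂, ∀ n : N', (f n : P) = e (1 ⊗ₜ[R] n) := by
  obtain ⟨θ, hθ, hθN⟩ := exists_coaction ψ₁ j₁ j₂ Φ hj₁ hc₂
  -- `e` carries the canonical datum of `S ⊗_R N′` to `θ`: check after the injective `c₂`
  have he' : ∀ y : S ⊗[R] N', θ (e y) =
      LinearMap.lTensor S (e.restrictScalars R) (LinearMap.lTensor S (TensorProduct.mk R S N' 1) y) := by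
    intro y
    apply hc₂.1
    rw [hθ]
    induction y using TensorProduct.induction_on with
    | zero => simp
    | tmul s n =>
        rw [LinearMap.lTensor_tmul, TensorProduct.mk_apply, LinearMap.lTensor_tmul, LinearMap.restrictScalars_apply,
          comparison_tmul, TensorProduct.tmul_eq_smul_one_tmul s n, LinearMap.map_smul, hj₁, LinearMap.map_smul, he]
    | add y z hy hz => rw [map_add, map_add, map_add, map_add, map_add, map_add, hy, hz]
  obtain ⟨f, hf⟩ := ModuleDescent.exists_linearEquiv_eqLocus R S θ e he' hbij
  exact ⟨f.trans (LinearEquiv.ofEq _ _ (eqLocus_eq j₁ j₂ Φ θ hθN)), fun n => by simpa using hf n⟩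

end Core

/-! ## §2 ADAPTERS: the instance-free comparison hypotheses `hc₂`, `hc₃` from `IsBaseChange` (in the `letI` dress of ★
`Modules/CechBaseChangeHom.isBaseChange_unitSectionLE`) and the torsor-square ring isomorphisms -/

section Adapters

variable {R : Type u} {S : Type v} {B : Type v₃} {T : Type v₂}
  [CommRing R] [CommRing S] [CommRing B] [CommRing T] [Algebra R S] [Algebra R B] [Algebra R T]
  (β : B →ₐ[R] T) (τ : S →ₐ[R] T)
  {P : Type w} [AddCommGroup P] [Module R P] [Module S P] [IsScalarTower R S P]
  {Q : Type w₂} [AddCommGroup Q] [Module R Q] [Module T Q] [IsScalarTower R T Q]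
  (k : P →ₗ[R] Q)

omit [Module S P] [IsScalarTower R S P] in
/-- The general comparison `B ⊗_R P → Q`, `b ⊗ x ↦ β b • k x`, on pure tensors. [cite: StacksProject, Tag 023M] -/
theorem lift_smul_tmul (b : B) (x : P) :
    TensorProduct.lift (((Algebra.lsmul R R Q : T →ₐ[R] Module.End R Q).toLinearMap ∘ₗ β.toLinearMap).compl₂ k) (b ⊗ₜ[R] x) =
      β b • k x := by
  simp [TensorProduct.lift.tmul, LinearMap.compl₂_apply]

/-- **GENERAL ADAPTER** (★ `AmitsurDescentData` pattern, one module up): if `B ⊗_R S → T`, `b ⊗ s ↦ β b * τ s` is BIJECTIVE (a pushout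
square of rings, e.g. the affine torsor square `Γ(W) ≅ Γ(U) ⊗_{Γ(V)} Γ(U)`) and the `τ`-semilinear `k : P → Q` exhibits `Q` as the BASE CHANGE
of `P` along `τ` (`IsBaseChange` for the `τ`-induced structures, as ★ `isBaseChange_unitSectionLE` states it), then the comparison `B ⊗_R P → Q`,
`b ⊗ x ↦ β b • k x`, is BIJECTIVE: `Q ≅ T ⊗_{S,τ} P ≅ (S ⊗_R B) ⊗_S P ≅ B ⊗_R P`. [cite: StacksProject, Tag 023M] [cite: GortzWedhorn2020, Prop. 14.66] -/
theorem bijective_lift_smul_of_isBaseChange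
    (hβτ : Function.Bijective (Algebra.TensorProduct.lift β τ (fun _ _ => Commute.all _ _)))
    (hk : ∀ (s : S) (x : P), k (s • x) = τ s • k x)
    (hb : letI := τ.toRingHom.toAlgebra
      letI : Module S Q := Module.compHom Q τ.toRingHom
      haveI : IsScalarTower S T Q := ⟨fun a b y => mul_smul (τ a) b y⟩
      IsBaseChange T (⟨⟨k, k.map_add⟩, hk⟩ : P →ₗ[S] Q)) :
    Function.Bijective
      (TensorProduct.lift (((Algebra.lsmul R R Q : T →ₐ[R] Module.End R Q).toLinearMap ∘ₗ β.toLinearMap).compl₂ k)) := by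
  letI := τ.toRingHom.toAlgebra
  letI : Module S Q := Module.compHom Q τ.toRingHom
  haveI : IsScalarTower S T Q := ⟨fun a b y => mul_smul (τ a) b y⟩
  haveI : IsScalarTower R S T := IsScalarTower.of_algebraMap_eq fun r => (τ.commutes r).symm
  -- `S ⊗_R B ≅ T` as an `S`-linear equivalence (`s ⊗ b ↦ τ s * β b`)
  let L : S ⊗[R] B →ₐ[S] T := Algebra.TensorProduct.lift (Algebra.ofId S T) β (fun _ _ => Commute.all _ _)
  have hL_tmul : ∀ (s : S) (b : B), L (s ⊗ₜ[R] b) = τ s * β b := fun s b => by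
    rw [Algebra.TensorProduct.lift_tmul]
    rfl
  have hL : Function.Bijective L := by
    have hfun : ⇑L = ⇑(Algebra.TensorProduct.lift β τ (fun _ _ => Commute.all _ _)) ∘ ⇑(Algebra.TensorProduct.comm R S B) := by
      funext z
      induction z using TensorProduct.induction_on with
      | zero => simp
      | tmul s b => rw [Function.comp_apply, Algebra.TensorProduct.comm_tmul, hL_tmul, Algebra.TensorProduct.lift_tmul, mul_comm]
      | add x y hx hy => simp only [map_add, Function.comp_apply] at hx hy ⊢; rw [hx, hy]
    rw [hfun]
    exact hβτ.comp (Algebra.TensorProduct.comm R S B).bijective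
  let eL : S ⊗[R] B ≃ₗ[S] T := LinearEquiv.ofBijective L.toLinearMap hL
  -- the chain `B ⊗_R P ≅ P ⊗_R B ≅ P ⊗_S (S ⊗_R B) ≅ P ⊗_S T ≅ T ⊗_S P ≅ Q`
  let F : B ⊗[R] P → Q := fun z =>
    hb.equiv (TensorProduct.comm S P T (LinearEquiv.lTensor P eL
      ((TensorProduct.AlgebraTensorModule.cancelBaseChange R S S P B).symm (TensorProduct.comm R B P z))))
  have hF : Function.Bijective F :=
    hb.equiv.bijective.comp ((TensorProduct.comm S P T).bijective.comp ((LinearEquiv.lTensor P eL).bijective.comp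
      ((TensorProduct.AlgebraTensorModule.cancelBaseChange R S S P B).symm.bijective.comp (TensorProduct.comm R B P).bijective)))
  have hFc : ∀ z, F z =
      TensorProduct.lift (((Algebra.lsmul R R Q : T →ₐ[R] Module.End R Q).toLinearMap ∘ₗ β.toLinearMap).compl₂ k) z := by
    intro z
    induction z using TensorProduct.induction_on with
    | zero => simp [F]
    | tmul b x =>
        simp only [F, TensorProduct.comm_tmul, TensorProduct.AlgebraTensorModule.cancelBaseChange_symm_tmul, LinearEquiv.lTensor_tmul]
        rw [lift_smul_tmul]
        change hb.equiv (TensorProduct.comm S P T (x ⊗ₜ[S] L (1 ⊗ₜ[R] b))) = _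
        rw [hL_tmul, map_one, one_mul, TensorProduct.comm_tmul, IsBaseChange.equiv_tmul]
        rfl
    | add x y hx hy => simp only [F, map_add] at hx hy ⊢; rw [hx, hy]
  have : ⇑(TensorProduct.lift (((Algebra.lsmul R R Q : T →ₐ[R] Module.End R Q).toLinearMap ∘ₗ β.toLinearMap).compl₂ k)) = F :=
    funext fun z => (hFc z).symm
  rw [this]
  exact hF

omit [IsScalarTower R S P] [IsScalarTower R T Q] in
/-- **COMPOSITION ADAPTER** (`IsBaseChange.comp` in the `letI` dress): base change along `τ : S → T` (by `k`) followed by base change along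
`π : T → U` (by `t`) is base change along `π ∘ τ` (by `t ∘ k`) — e.g. `Γ(W₃, (μ×1)^* snd^* E)` from `Γ(π⁻¹V, E)` through `Γ(W, snd^* E)`.
[cite: StacksProject, Tag 023M] -/
theorem isBaseChange_comp_of_isBaseChange {U : Type v₃} [CommRing U] [Algebra R U] (π : T →ₐ[R] U)
    {Q' : Type w₃} [AddCommGroup Q'] [Module R Q'] [Module U Q'] [IsScalarTower R U Q'] (t : Q →ₗ[R] Q')
    (hk : ∀ (s : S) (x : P), k (s • x) = τ s • k x) (ht : ∀ (s : T) (y : Q), t (s • y) = π s • t y)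
    (hbk : letI := τ.toRingHom.toAlgebra
      letI : Module S Q := Module.compHom Q τ.toRingHom
      haveI : IsScalarTower S T Q := ⟨fun a b y => mul_smul (τ a) b y⟩
      IsBaseChange T (⟨⟨k, k.map_add⟩, hk⟩ : P →ₗ[S] Q))
    (hbt : letI := π.toRingHom.toAlgebra
      letI : Module T Q' := Module.compHom Q' π.toRingHom
      haveI : IsScalarTower T U Q' := ⟨fun a b y => mul_smul (π a) b y⟩
      IsBaseChange U (⟨⟨t, t.map_add⟩, ht⟩ : Q →ₗ[T] Q')) :
    letI := (π.comp τ).toRingHom.toAlgebra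
    letI : Module S Q' := Module.compHom Q' (π.comp τ).toRingHom
    haveI : IsScalarTower S U Q' := ⟨fun a b y => mul_smul (π (τ a)) b y⟩
    IsBaseChange U (⟨⟨t ∘ₗ k, (t ∘ₗ k).map_add⟩, fun c x => by
        simp only [LinearMap.coe_comp, Function.comp_apply, hk, ht, RingHom.id_apply]; rfl⟩ : P →ₗ[S] Q') := by
  letI iST := τ.toRingHom.toAlgebra
  letI : Module S Q := Module.compHom Q τ.toRingHom
  haveI : IsScalarTower S T Q := ⟨fun a b y => mul_smul (τ a) b y⟩
  letI iTU := π.toRingHom.toAlgebra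
  letI : Module T Q' := Module.compHom Q' π.toRingHom
  haveI : IsScalarTower T U Q' := ⟨fun a b y => mul_smul (π a) b y⟩
  letI iSU := (π.comp τ).toRingHom.toAlgebra
  letI : Module S Q' := Module.compHom Q' (π.comp τ).toRingHom
  haveI : IsScalarTower S U Q' := ⟨fun a b y => mul_smul (π (τ a)) b y⟩
  haveI : IsScalarTower S T U := IsScalarTower.of_algebraMap_eq fun _ => rfl
  haveI : IsScalarTower S T Q' := ⟨fun a b y => by
    change π (τ a • b) • y = π (τ a) • (π b • y)
    rw [smul_eq_mul, map_mul, mul_smul]⟩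
  have h := IsBaseChange.comp hbk hbt
  convert h using 1
  exact LinearMap.ext fun _ => rfl

end Adapters

/-! ## §3 HEAD — (D1) with the base changes in `IsBaseChange` dress (what the scheme side feeds: ★ `isBaseChange_unitSectionLE` ×3 + the two
torsor-square ring isomorphisms `S ⊗_R S ≅ S₂`, `S ⊗_R S ⊗_R S ≅ S₃`) -/

section Head

variable {R : Type u} {S : Type v} {S₂ : Type v₂} {S₃ : Type v₃}
  [CommRing R] [CommRing S] [CommRing S₂] [CommRing S₃] [Algebra R S] [Algebra R S₂] [Algebra R S₃]
  (ψ₁ ψ₂ : S →ₐ[R] S₂) (π₁₂ π₁₃ π₂₃ : S₂ →ₐ[R] S₃) (d : S₂ →ₐ[R] S)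
  {P : Type w} [AddCommGroup P] [Module R P] [Module S P] [IsScalarTower R S P]
  {P₁ : Type w₁} [AddCommGroup P₁] [Module R P₁] [Module S₂ P₁] [IsScalarTower R S₂ P₁]
  {P₂ : Type w₂} [AddCommGroup P₂] [Module R P₂] [Module S₂ P₂] [IsScalarTower R S₂ P₂]
  {Q₂ : Type w₃} [AddCommGroup Q₂] [Module R Q₂] [Module S₃ Q₂]
  {Q₃ : Type w₄} [AddCommGroup Q₃] [Module R Q₃] [Module S₃ Q₃] [IsScalarTower R S₃ Q₃]
  (j₁ : P →ₗ[R] P₁) (j₂ : P →ₗ[R] P₂) (Φ : P₁ →ₗ[S₂] P₂) (ε : P₂ →ₗ[R] P)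
  (t₂ : P₂ →ₗ[R] Q₂) (t₃ t₃' : P₂ →ₗ[R] Q₃) (Φ₂₃ : Q₂ →ₗ[S₃] Q₃)

/-- **HEAD — EFFECTIVE DESCENT OF MODULES ON ONE CHART, `IsBaseChange` dress** ([SGA1] Exp. VIII Thm. 1.1; [StacksProject, Tag 023N];
[GortzWedhorn2020] Thm. 14.68).  Feed: `S ⊗_R S ≅ S₂` (`lift ψ₁ ψ₂` bijective, the torsor square `Γ(W) ≅ Γ(U) ⊗_{Γ(V)} Γ(U)`), `S ⊗_R S ⊗_R S ≅ S₃`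
(`lift (lift (π₁₂∘ψ₁) (π₁₂∘ψ₂)) (π₁₃∘ψ₂)` bijective, `Γ(W₃) ≅ Γ(U)^{⊗3}`), the base changes `j₂` (along `ψ₂`) and `t₃` (along `π₁₃`) as
`IsBaseChange` in the `letI` dress of ★ `Modules/CechBaseChangeHom.isBaseChange_unitSectionLE`, the datum `Φ` with its unit ∕ cocycle read on unit
sections, and `S` flat over `R`.  Then ANY injective `R`-linear `j : N → P` with range `{x | Φ (j₁ x) = j₂ x}` (the coinvariant sections) is a BASE
CHANGE: `S ⊗_R N ≅ P`, `s ⊗ n ↦ s • j n`. [cite: SGA1, Exp. VIII Thm. 1.1] [cite: StacksProject, Tag 023N] [cite: GortzWedhorn2020, Thm. 14.68] -/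
theorem isBaseChange_of_range_eq_of_isBaseChange [Module.Flat R S]
    (hψ : Function.Bijective (Algebra.TensorProduct.lift ψ₁ ψ₂ (fun _ _ => Commute.all _ _)))
    (hj₁ : ∀ (s : S) (x : P), j₁ (s • x) = ψ₁ s • j₁ x) (hj₂ : ∀ (s : S) (x : P), j₂ (s • x) = ψ₂ s • j₂ x)
    (hb₂ : letI := ψ₂.toRingHom.toAlgebra
      letI : Module S P₂ := Module.compHom P₂ ψ₂.toRingHom
      haveI : IsScalarTower S S₂ P₂ := ⟨fun a b y => mul_smul (ψ₂ a) b y⟩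
      IsBaseChange S₂ (⟨⟨j₂, j₂.map_add⟩, hj₂⟩ : P →ₗ[S] P₂))
    (hd : ∀ s : S, d (ψ₁ s) = s) (hε : ∀ (s : S₂) (y : P₂), ε (s • y) = d s • ε y) (hεj : ∀ x : P, ε (j₂ x) = x)
    (hunit : ∀ x : P, ε (Φ (j₁ x)) = x)
    (hF₁ : ∀ s : S, π₁₃ (ψ₁ s) = π₁₂ (ψ₁ s)) (hF₂ : ∀ s : S, π₂₃ (ψ₁ s) = π₁₂ (ψ₂ s))
    (ht₂ : ∀ (s : S₂) (y : P₂), t₂ (s • y) = π₁₂ s • t₂ y) (ht₃ : ∀ (s : S₂) (y : P₂), t₃ (s • y) = π₁₃ s • t₃ y)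
    (ht₃' : ∀ (s : S₂) (y : P₂), t₃' (s • y) = π₂₃ s • t₃' y) (hk₃ : ∀ x : P, t₃ (j₂ x) = t₃' (j₂ x))
    (hΦ₂₃ : ∀ x : P, Φ₂₃ (t₂ (j₂ x)) = t₃' (Φ (j₁ x)))
    (hcocycle : ∀ x : P, t₃ (Φ (j₁ x)) = Φ₂₃ (t₂ (Φ (j₁ x))))
    (hlift₃ : Function.Bijective (Algebra.TensorProduct.lift
      (Algebra.TensorProduct.lift (π₁₂.comp ψ₁) (π₁₂.comp ψ₂) (fun _ _ => Commute.all _ _)) (π₁₃.comp ψ₂)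
      (fun _ _ => Commute.all _ _)))
    (hb₃ : letI := π₁₃.toRingHom.toAlgebra
      letI : Module S₂ Q₃ := Module.compHom Q₃ π₁₃.toRingHom
      haveI : IsScalarTower S₂ S₃ Q₃ := ⟨fun a b y => mul_smul (π₁₃ a) b y⟩
      IsBaseChange S₃ (⟨⟨t₃, t₃.map_add⟩, ht₃⟩ : P₂ →ₗ[S₂] Q₃))
    {N : Type w'} [AddCommGroup N] [Module R N] (j : N →ₗ[R] P) (hjinj : Function.Injective j)
    (hj : ∀ x : P, x ∈ Set.range j ↔ Φ (j₁ x) = j₂ x) :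
    IsBaseChange S j := by
  -- `hc₂` from the degree-one base change and `S ⊗_R S ≅ S₂`
  have hc₂ := bijective_lift_smul_of_isBaseChange ψ₁ ψ₂ j₂ hψ hj₂ hb₂
  -- `hc₃` from the composite base change `t₃ ∘ j₂` (along `π₁₃ ∘ ψ₂`) and `S ⊗_R S ⊗_R S ≅ S₃`
  have hk : ∀ (s : S) (x : P), (t₃ ∘ₗ j₂) (s • x) = (π₁₃.comp ψ₂) s • (t₃ ∘ₗ j₂) x := fun s x => by
    simp only [LinearMap.coe_comp, Function.comp_apply, hj₂, ht₃, AlgHom.comp_apply]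
  have hb := isBaseChange_comp_of_isBaseChange ψ₂ j₂ π₁₃ t₃ hj₂ ht₃ hb₂ hb₃
  have hbig := bijective_lift_smul_of_isBaseChange
    (Algebra.TensorProduct.lift (π₁₂.comp ψ₁) (π₁₂.comp ψ₂) (fun _ _ => Commute.all _ _)) (π₁₃.comp ψ₂) (t₃ ∘ₗ j₂) hlift₃ hk hb
  have hc₃ := injective_comparison₃_of_injective ψ₁ ψ₂ π₁₂ j₂ t₃ hbig.1
  exact isBaseChange_of_range_eq ψ₁ ψ₂ π₁₂ π₁₃ π₂₃ d j₁ j₂ Φ ε t₂ t₃ t₃' Φ₂₃ hj₁ hc₂ hd hε hεj hunit hF₁ hF₂ ht₂ ht₃ ht₃' hk₃ hΦ₂₃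
    hcocycle hc₃ j hjinj hj

end Head

end Literature.RingTheory.Flat.ModuleDescentData
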